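import Literature.NumberTheory.GelbartRogawski1991.LocalSplittingCMBlockRestrictionLine
import Literature.NumberTheory.Automorphic.Liu2021.LemD1RankTwoCMLetters
import Literature.NumberTheory.GelbartRogawski1991.LocalSplittingCMGaloisTransportUndoubled
import HarnessLib

/-!
# The line-model local see-saw AT THE CM θ-PACKAGES: block `0` of the rank-`2` package section of `(λ, x)` over `diag(d₀, d₁)` is the
# rank-`1` package section of `(λ, x)` over `diag(d₀)`

Topic `NumberTheory/GelbartRogawski1991`; namespace `Literature.NumberTheory.GelbartRogawski1991.UnitaryDualPair.LocalSplitting.DoubledBlock`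
(sequel of ★ `LocalSplittingCMBlockRestrictionLine`).  THEOREMS ONLY (no definition, no named fact, no `sorry`, no instance, no notation).  Cell
`hodgecm-mathlib`, LD2 road R₂ ∕ (P′) (LD2-plan (g2) DEALS #3e pen (J)): `--supports stmt-HodgeConjecture-24832`.

For a CM field `L`, a real non-zero frame `dV : Fin 2 → L`, a conjugate-symplectic `λ`, a line `x ∈ (L⁺)ˣ` and a finite place `v`, the tree's rank-2 CM
θ-package section at `v` (`(congrW … (undoubledSplittings … (cmFinLocalFamily …))).s v`, [Liu2021, App. D §D.1 Steps 1–2]) read in the LINE MODEL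
(★ `lineTransportSection`, the currency of LD1-p01's `hsep` ∕ ★ `F0LD1SameLabelRigidityOfSeparation`), restricted to the block `U(diag d₀) × 1`, acts on
`f₁ ⊠ f₂` as the rank-ONE CM θ-package section of the SAME `(λ, x)` over the frame `dV₁` (`dV₁ 0 = dV 0`) on `f₁`, tensor `f₂`:
`toRep_lineTransportSection_pkg₂_inlLoc_boxSB`.  Ingredients: ★ `congrW_undoubledSplittings_cmFinLocalFamily_s` (the package section IS
`localSplittingCM = localSplittingCMWith … addHaar`), ★ `toRep_lineTransportSection_localSplittingCMWith_inlLoc_boxSB_of_eq` (the line-model local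
see-saw, Kudla rigidity) at `T_V := realDiagonal L dV hdV = realDiagonal L dV₁ hdV₁ ⊕ᶠ realDiagonal L dV₂ hdV₂` (`realDiagonal_eq_finSum`).
The token contract of the rank-one section is HOME `F0/P6/A-p19/g30/J/RANK1-SECTION-shape.LD2-Pprime-organ.A-p19g30.txt`.
HC_CM is proved only modulo the printed citations (2 remaining named inputs hLiu418 = stmt-HodgeConjecture-24832, h413 = 24833) until rung 0
closes; count-neutral.

## References
* [Kudla1994] S. Kudla, Israel J. Math. 87 (1994), §3 Thm. 3.1.  [Kudla1984] S. Kudla, Progr. Math. 46 (1984), §1.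
* [GelbartRogawski1991] S. Gelbart, J. Rogawski, Invent. Math. 105 (1991), §3.1 Prop. 3.1.1 p. 455.
* [Liu2021] Y. Liu, Camb. J. Math. 9 (2021), App. D §D.1 Steps 1–2 (l. 5217–5219), Lem. D.1 (4).
-/

set_option autoImplicit false

noncomputable section

open scoped Matrix Kronecker
open NumberField IsDedekindDomain MeasureTheory
open Literature.RepresentationTheory.HeisenbergGroup
open Literature.NumberTheory Literature.NumberTheory.Automorphic Literature.NumberTheory.Automorphic.UnitaryGroup
open Literature.NumberTheory.GelbartRogawski1991 Literature.NumberTheory.GelbartRogawski1991.UnitaryDualPair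
open Literature.NumberTheory.GelbartRogawski1991.UnitaryDualPair.LocalSplitting
open Literature.NumberTheory.GelbartRogawski1991.GRConstruction
open Literature.NumberTheory.Weil1964 Literature.RepresentationTheory
open Literature.NumberTheory.GaloisRepresentations Literature.RepresentationTheory.HarrisKudlaSweet1996
open Literature.NumberTheory.Automorphic.IdeleClassGroup Literature.RepresentationTheory.Liu2021
open Literature.NumberTheory.Automorphic.Liu2021 Literature.NumberTheory.Automorphic.Liu2021.Def411WeilCarriers
open Literature.NumberTheory.Automorphic.Liu2021.Def411WeilCarriersDoubling

namespace Literature.NumberTheory.GelbartRogawski1991.UnitaryDualPair.LocalSplitting.DoubledBlock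

variable (L : Type) [Field L] [NumberField L] [IsCMField L]
  (dV : Fin 2 → L) (hdV : ∀ i, IsCMField.complexConj L (dV i) = dV i) (hdV0 : ∀ i, dV i ≠ 0)
  (dV₁ : Fin 1 → L) (hdV₁ : ∀ i, IsCMField.complexConj L (dV₁ i) = dV₁ i) (hdV0₁ : ∀ i, dV₁ i ≠ 0)
  {T₂ : Matrix (Fin 1) (Fin 1) (Fp L)} (hT₂ : T₂.IsSymm) (hT₂d : IsUnit T₂.det)
  (hTV : realDiagonal L dV hdV = UnitaryGroup.finSum 1 1 (realDiagonal L dV₁ hdV₁) T₂)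
  (lam : Literature.NumberTheory.Automorphic.IdeleClassGroup L →ₜ* Circle) (hlam : IsConjugateSymplectic L lam)
  (x : (Fp L)ˣ) (v : HeightOneSpectrum (𝓞 (Fp L)))

set_option maxHeartbeats 3200000 in -- two CM package telescopes + the doubled CM datum (★ see-saw files use 1600000 for one)
include hdV0 hdV0₁ hT₂ hT₂d hTV hlam in
/-- **BLOCK `0` OF THE RANK-2 CM θ-PACKAGE IS THE RANK-1 CM θ-PACKAGE (line model, same `λ`, same line `x`).**  With
`T_V = realDiagonal L dV hdV = realDiagonal L dV₁ hdV₁ ⊕ᶠ T₂` (`hTV`, the consumer's frame junction), for every `g ∈ U(diag dV₁)(L⁺_v)` and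
`f₁, f₂ ∈ 𝒮(L⁺_v)`:  `ω_{T_V}(s⁽²⁾(g ⊕ 1))(f₁ ⊠ f₂) = ω_{diag dV₁}(s⁽¹⁾ g) f₁ ⊠ f₂`, where `s⁽ᴺ⁾` is the line-transported section of the tree's
rank-`N` CM θ-package of `(λ, x)` (HOME token contract `RANK1-SECTION-shape…txt` for `N = 1`).
[cite: Kudla1994, §3 Thm. 3.1] [cite: Kudla1984, §1] [cite: Liu2021, App. D §D.1 Steps 1–2 (l. 5217–5219)] -/
theorem toRep_lineTransportSection_pkg₂_inlLoc_boxSB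
    (g : localPi L (IsCMField.complexConj L) 1 (Matrix.diagonal dV₁) v)
    (f₁ f₂ : SchwartzBruhat (Fin 1 → v.adicCompletion (Fp L))) :
    MpPsi.toRep (localSchrodinger (Fp L) 2 (realDiagonal L dV hdV) v)
        ((lineTransportSection (Fp L) L (IsCMField.complexConj L) 2 (complexConj_imagUnit L) (imagUnit_ne_zero L) (imagUnit_mul_self L) (realDiagonal L dV hdV) (realDiagonal_isSymm L dV hdV) (Matrix.diagonal dV) (realDiagonal_map L dV hdV).symm x v ((congrW L (Equiv.prodUnique (Fin 2) (Fin 1)) dV hdV (lineW L (TW (Fp L) x)) (complexConj_lineW L (TW (Fp L) x)) (realDiagonal_lineW L (TW (Fp L) x)) (diagonal_lineW L (TW (Fp L) x) (JW_eq (Fp L) L x)) (undoubledSplittings L (Equiv.prodUnique (Fin 2) (Fin 1)) dV hdV hdV0 (lineW L (TW (Fp L) x)) (complexConj_lineW L (TW (Fp L) x)) (lineW_ne_zero L (TW (Fp L) x) (isUnit_det_TW (Fp L) x)) (toHeckeCharacter L lam) (borelPlaceMeasure L) (cmFinLocalFamily L (Equiv.prodUnique (Fin 2) (Fin 1)) dV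 hdV hdV0 (lineW L (TW (Fp L) x)) (complexConj_lineW L (TW (Fp L) x)) (lineW_ne_zero L (TW (Fp L) x) (isUnit_det_TW (Fp L) x)) (toHeckeCharacter L lam) ((isOscillatorChar_toHeckeCharacter_iff lam).mpr hlam) (borelPlaceMeasure L))) (isSymm_TW (Fp L) x) (JW_eq (Fp L) L x)).s v) ((congrW L (Equiv.prodUnique (Fin 2) (Fin 1)) dV hdV (lineW L (TW (Fp L) x)) (complexConj_lineW L (TW (Fp L) x)) (realDiagonal_lineW L (TW (Fp L) x)) (diagonal_lineW L (TW (Fp L) x) (JW_eq (Fp L) L x)) (undoubledSplittings L (Equiv.prodUnique (Fin 2) (Fin 1)) dV hdV hdV0 (lineW L (TW (Fp L) x)) (complexConj_lineW L (TW (Fp L) x)) (lineW_ne_zero L (TW (Fp L) x) (isUnit_det_TW (Fp L) x)) (toHeckeCharacter L lam) (borelPlaceMeasure L) (cmFinLocalFamily L (Equiv.prodUnique (Fin 2) (Fin 1)) dV hdV hdV0 (lineW L (TW (Fp L) x)) (complexConj_lineW L (TW (Fp L) x)) (lineW_ne_zero L (TW (Fp L) x) (isUnit_det_TW (Fp L)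 x)) (toHeckeCharacter L lam) ((isOscillatorChar_toHeckeCharacter_iff lam).mpr hlam) (borelPlaceMeasure L))) (isSymm_TW (Fp L) x) (JW_eq (Fp L) L x)).proj_s v))
          (BlockSum.inlLoc (Fp L) L (IsCMField.complexConj L) v 1 1 (realDiagonal_map L dV₁ hdV₁).symm
            ((realDiagonal_map L dV hdV).symm.trans (by rw [hTV])) g))
        (boxSB (v.adicCompletion (Fp L)) (finSumFinEquiv : Fin 1 ⊕ Fin 1 ≃ Fin (1 + 1)) f₁ f₂) =
      boxSB (v.adicCompletion (Fp L)) (finSumFinEquiv : Fin 1 ⊕ Fin 1 ≃ Fin (1 + 1))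
        (MpPsi.toRep (localSchrodinger (Fp L) 1 (realDiagonal L dV₁ hdV₁) v) ((lineTransportSection (Fp L) L (IsCMField.complexConj L) 1 (complexConj_imagUnit L) (imagUnit_ne_zero L) (imagUnit_mul_self L) (realDiagonal L dV₁ hdV₁) (realDiagonal_isSymm L dV₁ hdV₁) (Matrix.diagonal dV₁) (realDiagonal_map L dV₁ hdV₁).symm x v ((congrW L (Equiv.prodUnique (Fin 1) (Fin 1)) dV₁ hdV₁ (lineW L (TW (Fp L) x)) (complexConj_lineW L (TW (Fp L) x)) (realDiagonal_lineW L (TW (Fp L) x)) (diagonal_lineW L (TW (Fp L) x) (JW_eq (Fp L) L x)) (undoubledSplittings L (Equiv.prodUnique (Fin 1) (Fin 1)) dV₁ hdV₁ hdV0₁ (lineW L (TW (Fp L) x)) (complexConj_lineW L (TW (Fp L) x)) (lineW_ne_zero L (TW (Fp L) x) (isUnit_det_TW (Fp L) x)) (toHeckeCharacter L lam) (borelPlaceMeasure L) (cmFinLocalFamily L (Equiv.prodUnique (Fin 1) (Fin 1)) dV₁ hdV₁ hdV0₁ (lineW L (TW (Fp L) x)) (complexConj_lineW L (TW (Fp L)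 x)) (lineW_ne_zero L (TW (Fp L) x) (isUnit_det_TW (Fp L) x)) (toHeckeCharacter L lam) ((isOscillatorChar_toHeckeCharacter_iff lam).mpr hlam) (borelPlaceMeasure L))) (isSymm_TW (Fp L) x) (JW_eq (Fp L) L x)).s v) ((congrW L (Equiv.prodUnique (Fin 1) (Fin 1)) dV₁ hdV₁ (lineW L (TW (Fp L) x)) (complexConj_lineW L (TW (Fp L) x)) (realDiagonal_lineW L (TW (Fp L) x)) (diagonal_lineW L (TW (Fp L) x) (JW_eq (Fp L) L x)) (undoubledSplittings L (Equiv.prodUnique (Fin 1) (Fin 1)) dV₁ hdV₁ hdV0₁ (lineW L (TW (Fp L) x)) (complexConj_lineW L (TW (Fp L) x)) (lineW_ne_zero L (TW (Fp L) x) (isUnit_det_TW (Fp L) x)) (toHeckeCharacter L lam) (borelPlaceMeasure L) (cmFinLocalFamily L (Equiv.prodUnique (Fin 1) (Fin 1)) dV₁ hdV₁ hdV0₁ (lineW L (TW (Fp L) x)) (complexConj_lineW L (TW (Fp L) x)) (lineW_ne_zero L (TW (Fp L) x) (isUnit_det_TW (Fp L) x)) (toHeckeCharacter L lam) ((isOscillatorChar_toHeckeCharacter_iff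 lam).mpr hlam) (borelPlaceMeasure L))) (isSymm_TW (Fp L) x) (JW_eq (Fp L) L x)).proj_s v)) g) f₁) f₂ := by
  -- the two package sections ARE `localSplittingCM` (★ `congrW_undoubledSplittings_cmFinLocalFamily_s`)
  have e₂ := congrW_undoubledSplittings_cmFinLocalFamily_s L (Equiv.prodUnique (Fin 2) (Fin 1)) dV hdV hdV0
    (lineW L (TW (Fp L) x)) (complexConj_lineW L (TW (Fp L) x)) (lineW_ne_zero L (TW (Fp L) x) (isUnit_det_TW (Fp L) x))
    (toHeckeCharacter L lam) ((isOscillatorChar_toHeckeCharacter_iff lam).mpr hlam)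
    (realDiagonal_lineW L (TW (Fp L) x)) (diagonal_lineW L (TW (Fp L) x) (JW_eq (Fp L) L x)) (isSymm_TW (Fp L) x) (isUnit_det_TW (Fp L) x)
    (JW_eq (Fp L) L x) v
  have e₁ := congrW_undoubledSplittings_cmFinLocalFamily_s L (Equiv.prodUnique (Fin 1) (Fin 1)) dV₁ hdV₁ hdV0₁
    (lineW L (TW (Fp L) x)) (complexConj_lineW L (TW (Fp L) x)) (lineW_ne_zero L (TW (Fp L) x) (isUnit_det_TW (Fp L) x))
    (toHeckeCharacter L lam) ((isOscillatorChar_toHeckeCharacter_iff lam).mpr hlam)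
    (realDiagonal_lineW L (TW (Fp L) x)) (diagonal_lineW L (TW (Fp L) x) (JW_eq (Fp L) L x)) (isSymm_TW (Fp L) x) (isUnit_det_TW (Fp L) x)
    (JW_eq (Fp L) L x) v
  suffices H : ∀ (s₂' : _ →* _) (hs₂' : _) (s₁' : _ →* _) (hs₁' : _), s₂' = _ → s₁' = _ →
    MpPsi.toRep (localSchrodinger (Fp L) 2 (realDiagonal L dV hdV) v)
        ((lineTransportSection (Fp L) L (IsCMField.complexConj L) 2 (complexConj_imagUnit L) (imagUnit_ne_zero L) (imagUnit_mul_self L) (realDiagonal L dV hdV) (realDiagonal_isSymm L dV hdV) (Matrix.diagonal dV) (realDiagonal_map L dV hdV).symm x v s₂' hs₂')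
          (BlockSum.inlLoc (Fp L) L (IsCMField.complexConj L) v 1 1 (realDiagonal_map L dV₁ hdV₁).symm
            ((realDiagonal_map L dV hdV).symm.trans (by rw [hTV])) g))
        (boxSB (v.adicCompletion (Fp L)) (finSumFinEquiv : Fin 1 ⊕ Fin 1 ≃ Fin (1 + 1)) f₁ f₂) =
      boxSB (v.adicCompletion (Fp L)) (finSumFinEquiv : Fin 1 ⊕ Fin 1 ≃ Fin (1 + 1))
        (MpPsi.toRep (localSchrodinger (Fp L) 1 (realDiagonal L dV₁ hdV₁) v) ((lineTransportSection (Fp L) L (IsCMField.complexConj L) 1 (complexConj_imagUnit L) (imagUnit_ne_zero L) (imagUnit_mul_self L) (realDiagonal L dV₁ hdV₁) (realDiagonal_isSymm L dV₁ hdV₁) (Matrix.diagonal dV₁) (realDiagonal_map L dV₁ hdV₁).symm x v s₁' hs₁') g) f₁) f₂ from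
    H _ _ _ _ e₂ e₁
  intro s₂' hs₂' s₁' hs₁' h₂ h₁
  subst h₂ h₁
  letI : MeasurableSpace (v.adicCompletion (Fp L)) := borel _
  haveI : BorelSpace (v.adicCompletion (Fp L)) := ⟨rfl⟩
  exact toRep_lineTransportSection_localSplittingCMWith_inlLoc_boxSB_of_eq L v Measure.addHaar 1 1 (realDiagonal_isSymm L dV₁ hdV₁) hT₂
    (isUnit_det_realDiagonal L dV₁ hdV₁ hdV0₁) hT₂d (realDiagonal_map L dV₁ hdV₁).symm hTV (realDiagonal_isSymm L dV hdV)
    (isUnit_det_realDiagonal L dV hdV hdV0) (realDiagonal_map L dV hdV).symm (toHeckeCharacter L lam)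
    ((isOscillatorChar_toHeckeCharacter_iff lam).mpr hlam) x Nat.one_pos _ rfl g f₁ f₂

end Literature.NumberTheory.GelbartRogawski1991.UnitaryDualPair.LocalSplitting.DoubledBlock

end
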